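import Mathlib
import Summits.Ventures.HodgeRepro2.T5AdicCompletionInert
import Summits.Ventures.HodgeRepro2.T5AdicCompletionRamified

/-!
# Infinitely many characters trivial on the base, at every quadratic place

Theorem N5.T2′ of `route/TIER5.md` §N5.12.2 («the set of attainable `Ξ_v` is INFINITE in the
cases (iii-inert)′ and (β)») and Lemma N5.L3′ use that the conjugate-orthogonal characters of
`E_v^×` form an infinite set — at an inert place from the characters of every exact conductor
`a ≥ 1` (`T5AdicCompletionInert`), at a ramified place from those of every even exact conductor
`2k ≥ 2` (`T5AdicCompletionRamified`). This file records the counting step: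

* `infinite_of_exists_exact_level`: for an antitone filtration `U` of a group `G` and a set `P`
  of characters, if `P` contains a character of exact level `n` (trivial on `U (n+1)`, not on
  `U n`) for every `n` in an infinite set of levels, then `P` is infinite — characters of
  distinct exact levels are distinct;
* `infinite_setOf_trivial_on_base_of_quadratic_inert` /
  `infinite_setOf_trivial_on_base_of_quadratic_ramified`: on Mathlib's completions
  `Kv ⊆ Lw` at a quadratic place, inert (`ϖ_K` stays a uniformiser) or ramified (it does not),
  the characters of `O_{Lw}ˣ` trivial on the image of `O_{Kv}ˣ` form an infinite set;
* `infinite_setOf_trivial_on_base_of_quadratic`: the two cases combined — at EVERY quadratic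
  place of Mathlib's completions.

Declaration per README §8(d): «uses an L-value-free non-vanishing device: NO».
-/

namespace Summit.Ventures.HodgeRepro2.T5InfinitelyManyCharacters

open T5PrincipalUnitFiltration T5PrincipalUnitComparison IsDedekindDomain HeightOneSpectrum

section Abstract

variable {G M : Type*} [Group G] [MulOneClass M]

/-- Characters of distinct exact levels along an antitone filtration are distinct, so a set of
characters containing one of exact level `n` for every `n` in an infinite set of levels is
infinite. -/
theorem infinite_of_exists_exact_level (U : ℕ → Subgroup G) (hU : Antitone U)
    (P : Set (G →* M)) {N : Set ℕ} (hN : N.Infinite)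
    (h : ∀ n ∈ N, ∃ χ ∈ P, (∀ y ∈ U (n + 1), χ y = 1) ∧ ∃ y ∈ U n, χ y ≠ 1) : P.Infinite := by
  choose! f hfP hf1 hf2 using h
  refine Set.infinite_of_injOn_mapsTo (f := f) ?_ (fun n hn => hfP n hn) hN
  intro m hm n hn hmn
  by_contra hne
  rcases lt_or_gt_of_ne hne with hlt | hlt
  · -- `m < n`: `f m` is trivial on `U (m+1) ⊇ U n`, but `f n = f m` is non-trivial on `U n`
    obtain ⟨y, hy, hy'⟩ := hf2 n hn
    apply hy'
    rw [← hmn]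
    exact hf1 m hm y (hU (by omega : m + 1 ≤ n) hy)
  · obtain ⟨y, hy, hy'⟩ := hf2 m hm
    apply hy'
    rw [hmn]
    exact hf1 n hn y (hU (by omega : n + 1 ≤ m) hy)

end Abstract

section Concrete

variable {K : Type*} [Field K] [NumberField K] (v : HeightOneSpectrum (NumberField.RingOfIntegers K))
variable {L : Type*} [Field L] [NumberField L] [Algebra K L]
  (w : HeightOneSpectrum (NumberField.RingOfIntegers L))
variable [Algebra (adicCompletion K v) (adicCompletion L w)]
  [ContinuousSMul (adicCompletion K v) (adicCompletion L w)]
  [IsScalarTower K (adicCompletion K v) (adicCompletion L w)]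


/-- At a quadratic INERT place the characters of `O_{Lw}ˣ` trivial on the image of `O_{Kv}ˣ`
form an infinite set (one of every exact level, `T5AdicCompletionInert`). -/
theorem infinite_setOf_trivial_on_base_of_quadratic_inert
    (hfin : Module.finrank (adicCompletion K v) (adicCompletion L w) = 2)
    {ϖ : (adicCompletionIntegers K v)} (hϖ : Irreducible ϖ) (hϖL : Irreducible (algebraMap (adicCompletionIntegers K v) (adicCompletionIntegers L w) ϖ)) :
    {χ : (adicCompletionIntegers L w)ˣ →* ℂˣ | ∀ r : (adicCompletionIntegers K v)ˣ, χ (unitsMap r) = 1}.Infinite :=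
  infinite_of_exists_exact_level (higherUnits (algebraMap (adicCompletionIntegers K v) (adicCompletionIntegers L w) ϖ))
    (higherUnits_antitone _) _ (N := Set.univ) Set.infinite_univ (fun n _ => by
      obtain ⟨χ, h1, h2, h3⟩ :=
        T5AdicCompletionInert.exists_character_exact_level_of_quadratic_inert v w hfin hϖ hϖL n
      exact ⟨χ, h2, h1, h3⟩)

/-- At a quadratic RAMIFIED place the characters of `O_{Lw}ˣ` trivial on the image of `O_{Kv}ˣ`
form an infinite set (one of every even exact level, `T5AdicCompletionRamified`). -/
theorem infinite_setOf_trivial_on_base_of_quadratic_ramified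
    (hfin : Module.finrank (adicCompletion K v) (adicCompletion L w) = 2)
    {ϖ : (adicCompletionIntegers K v)} (hϖ : Irreducible ϖ) {π : (adicCompletionIntegers L w)} (hπ : Irreducible π)
    (hram : ¬ Irreducible (algebraMap (adicCompletionIntegers K v) (adicCompletionIntegers L w) ϖ)) :
    {χ : (adicCompletionIntegers L w)ˣ →* ℂˣ | ∀ r : (adicCompletionIntegers K v)ˣ, χ (unitsMap r) = 1}.Infinite :=
  infinite_of_exists_exact_level (higherUnits π) (higherUnits_antitone _) _
    (N := Set.range fun k : ℕ => 2 * k + 1)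
    (Set.infinite_range_of_injective fun _ _ h => by omega) (fun n hn => by
      obtain ⟨k, rfl⟩ := hn
      obtain ⟨χ, h1, h2, h3⟩ :=
        T5AdicCompletionRamified.exists_character_exact_even_level_of_quadratic_ramified
          v w hfin hϖ hπ hram k
      exact ⟨χ, h2, h1, h3⟩)

/-- At EVERY quadratic place of Mathlib's completions the characters of `O_{Lw}ˣ` trivial on
the image of `O_{Kv}ˣ` («conjugate-orthogonal characters at the level of the units») form an
infinite set. -/
theorem infinite_setOf_trivial_on_base_of_quadratic
    (hfin : Module.finrank (adicCompletion K v) (adicCompletion L w) = 2)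
    {ϖ : (adicCompletionIntegers K v)} (hϖ : Irreducible ϖ) {π : (adicCompletionIntegers L w)} (hπ : Irreducible π) :
    {χ : (adicCompletionIntegers L w)ˣ →* ℂˣ | ∀ r : (adicCompletionIntegers K v)ˣ, χ (unitsMap r) = 1}.Infinite := by
  by_cases h : Irreducible (algebraMap (adicCompletionIntegers K v) (adicCompletionIntegers L w) ϖ)
  · exact infinite_setOf_trivial_on_base_of_quadratic_inert v w hfin hϖ h
  · exact infinite_setOf_trivial_on_base_of_quadratic_ramified v w hfin hϖ hπ h

end Concrete

end Summit.Ventures.HodgeRepro2.T5InfinitelyManyCharacters
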